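import Mathlib
import HarnessLib
import Summits.Ventures.LatticeQCDFlow.Scoring.ChainMartingaleIncrements

/-!
# The fourth moment of the block martingale, `E[M_{s,n}⁴] ≤ 48 C_h⁴ n²`, and the moments of block
# sums of a Poisson image from any start: `E[(Σ_{t<n} f̄(X_{s+t}))²] ≤ 10 C_h² n`, `E[(…)⁴] ≤ 512 C_h⁴ n²`

HONEST FRAMING: exact (Metropolis-corrected) sampling algorithms for lattice gauge theory;
figures of merit are autocorrelation/cost numbers at stated couplings and volumes; no
continuum-physics claim.

Venture `LatticeQCDFlow` (cell pub-lqcd), topic `Scoring`; FANOUT row 8 (`s0-cpn-nemc`, GEN-19).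
NEW WORK of the cell, not a published result; no definition is introduced.  Continuation of
`Scoring/ChainMartingaleIncrements.lean` (notation as there: `P_{μ₀}` the chain's path law from any
initial law, `|h| ≤ C_h`, `D_t = h(X_{t+1}) − kop κ h(X_t)`, `M_{s,n} = Σ_{t<n} D_{s+t}`).  From the
pointwise inequality `(m + δ)⁴ ≤ m⁴ + 4 m³ δ + 8 m² δ² + 3 δ⁴`, orthogonality (`E[M³ D] = 0`), the
conditional second moment (`E[M² D²] = E[M² q] ≤ C_h² E[M²] ≤ n C_h⁴`) and `|D| ≤ 2 C_h`, induction on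
`n` gives `E_{μ₀}[M_{s,n}⁴] ≤ (4n² + 44n) C_h⁴ ≤ 48 C_h⁴ n²` — a Burkholder-type bound with explicit
constant, from any start.  If `h` solves the Poisson equation `h − kop κ h = f̄` the block sum
TELESCOPES, `Σ_{t<n} f̄(X_{s+t}) = M_{s,n} + h(X_s) − h(X_{s+n})`, whence the second- and fourth-moment
bounds of block sums of `f̄`, uniformly in the block position `s` and in the initial law — the
fourth-moment input of the consistency of batch means (`Scoring/BatchMeansConsistency.lean`); the
minorised (Doeblin) packaging with the tree's Poisson solution is `Scoring/ChainBlockSumMoments.lean`.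
Printed counterparts NAMED ONLY, nothing cited as a fact: Burkholder's inequality for martingale
differences (Burkholder 1966); the Poisson-equation route (Meyn–Tweedie 1993 §17.4).

## Content

* `add_pow_four_le` — `(m + δ)⁴ ≤ m⁴ + 4 m³ δ + 8 m² δ² + 3 δ⁴`;
* **`chain_blockMartingale_fourth_le`** — `E[M_{s,n}⁴] ≤ (4 n² + 44 n) C_h⁴`;
  `chain_blockMartingale_fourth_le'` — `≤ 48 C_h⁴ n²` (`n ≥ 1`);
* `blockSum_eq_blockMartingale_add` — telescoping for a Poisson solution (pointwise);
* **`chain_blockSum_sq_le_of_poisson`** — `E_{μ₀}[(Σ_{t<n} f̄(X_{s+t}))²] ≤ 10 C_h² n` (`n ≥ 1`);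
* **`chain_blockSum_fourth_le_of_poisson`** — `E_{μ₀}[(Σ_{t<n} f̄(X_{s+t}))⁴] ≤ 512 C_h⁴ n²` (`n ≥ 1`).

NOT CLAIMED: sharp constants; unbounded observables; anything about a concrete sampler.
-/

noncomputable section

namespace Summit.Ventures.LatticeQCDFlow.Scoring

open MeasureTheory ProbabilityTheory Filter Finset Preorder Literature.Probability.MarkovChains
open scoped ENNReal Topology

variable {Ω : Type*} [MeasurableSpace Ω]

omit [MeasurableSpace Ω] in
/-- The pointwise fourth-power inequality `(m + δ)⁴ ≤ m⁴ + 4 m³ δ + 8 m² δ² + 3 δ⁴`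
(`4 m δ³ ≤ 2 m² δ² + 2 δ⁴`). -/
theorem add_pow_four_le (m δ : ℝ) :
    (m + δ) ^ 4 ≤ m ^ 4 + 4 * (m ^ 3 * δ) + 8 * (m ^ 2 * δ ^ 2) + 3 * δ ^ 4 := by
  nlinarith [sq_nonneg (δ * (m - δ)), sq_nonneg δ, sq_nonneg (m - δ)]


section BlockMartingale

variable (κ : Kernel Ω Ω) [IsMarkovKernel κ] (μ₀ : Measure Ω) [IsProbabilityMeasure μ₀]

/-- **`E[M_{s,n}⁴] ≤ 48 C_h⁴ n²`** (precisely `≤ (4 n² + 44 n) C_h⁴`). -/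
theorem chain_blockMartingale_fourth_le {h : Ω → ℝ} (hh : Measurable h) {Ch : ℝ}
    (hCh : ∀ x, |h x| ≤ Ch) (s : ℕ) : ∀ n : ℕ,
    ∫ x, (∑ t ∈ Finset.range n, (h (x (s + t + 1)) - kop κ h (x (s + t)))) ^ 4
        ∂(Kernel.trajMeasure (X := fun _ : ℕ => Ω) μ₀
          (fun n : ℕ => κ.comap (fun h : (i : ↥(Finset.Iic n)) → Ω => h ⟨n, Finset.mem_Iic.2 le_rfl⟩)
            (measurable_pi_apply _)))
      ≤ (4 * (n : ℝ) ^ 2 + 44 * n) * Ch ^ 4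
  | 0 => by simp
  | n + 1 => by
    set P := Kernel.trajMeasure (X := fun _ : ℕ => Ω) μ₀
        (fun n : ℕ => κ.comap (fun h : (i : ↥(Finset.Iic n)) → Ω => h ⟨n, Finset.mem_Iic.2 le_rfl⟩)
          (measurable_pi_apply _)) with hP
    have ih := chain_blockMartingale_fourth_le hh hCh s n
    rw [← hP] at ih
    have hM2 := chain_blockMartingale_sq_le κ μ₀ hh hCh s n
    rw [← hP] at hM2
    have hCh0 : 0 ≤ Ch := (abs_nonneg _).trans (hCh (Classical.choice
      (nonempty_of_isProbabilityMeasure μ₀)))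
    set M : (ℕ → Ω) → ℝ := fun x =>
      ∑ t ∈ Finset.range n, (h (x (s + t + 1)) - kop κ h (x (s + t))) with hMdef
    set D : (ℕ → Ω) → ℝ := fun x => h (x (s + n + 1)) - kop κ h (x (s + n)) with hDdef
    have hMm : Measurable M := blockMartingale_measurable κ hh s n
    have hMb : ∀ x, |M x| ≤ n * (2 * Ch) := abs_blockMartingale_le κ hCh s n
    have hMd : DependsOn M (Set.Iic (s + n)) := blockMartingale_dependsOn (kop κ) h s n
    have hDm : Measurable D :=
      (hh.comp (measurable_pi_apply _)).sub ((measurable_kop κ hh).comp (measurable_pi_apply _))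
    have hDb : ∀ x, |D x| ≤ 2 * Ch := fun x =>
      (abs_sub _ _).trans (by linarith [hCh (x (s + n + 1)), abs_kop_le κ hCh (x (s + n))])
    -- `E[M³ D] = 0`
    have hM3m : Measurable fun x => M x ^ 3 := hMm.pow_const 3
    have hM3b : ∀ x, |M x ^ 3| ≤ (n * (2 * Ch)) ^ 3 := fun x => by
      rw [abs_pow]; exact pow_le_pow_left₀ (abs_nonneg _) (hMb x) 3
    have hM3d : DependsOn (fun x => M x ^ 3) (Set.Iic (s + n)) := fun x y hxy => by
      show M x ^ 3 = M y ^ 3; rw [hMd hxy]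
    have horth := chain_increment_orthogonal κ μ₀ (s + n) hM3m hM3d hM3b hh hCh
    rw [← hP] at horth
    -- `E[M² D²] = E[M² q] ≤ C_h² E[M²]`
    have hM2m : Measurable fun x => M x ^ 2 := hMm.pow_const 2
    have hM2b : ∀ x, |M x ^ 2| ≤ (n * (2 * Ch)) ^ 2 := fun x => by
      rw [abs_pow]; exact pow_le_pow_left₀ (abs_nonneg _) (hMb x) 2
    have hM2d : DependsOn (fun x => M x ^ 2) (Set.Iic (s + n)) := fun x y hxy => by
      show M x ^ 2 = M y ^ 2; rw [hMd hxy]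
    have hsq := chain_increment_sq κ μ₀ (s + n) hM2m hM2d hM2b hh hCh
    rw [← hP] at hsq
    obtain ⟨hqm, hqb⟩ := kopCondVar_bounded_measurable κ hh hCh
    have hM2q : ∫ x, M x ^ 2 * (kop κ (fun y => h y ^ 2) (x (s + n)) - (kop κ h (x (s + n))) ^ 2) ∂P
        ≤ Ch ^ 2 * ∫ x, M x ^ 2 ∂P := by
      rw [← integral_const_mul]
      refine integral_mono_of_nonneg (ae_of_all _ fun x => mul_nonneg (sq_nonneg _)
        (kopCondVar_nonneg κ hh hCh _)) ((integrable_of_bounded P hM2m hM2b).const_mul _)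
        (ae_of_all _ fun x => ?_)
      show M x ^ 2 * _ ≤ Ch ^ 2 * M x ^ 2
      rw [mul_comm (Ch ^ 2)]
      exact mul_le_mul_of_nonneg_left (kopCondVar_le κ hCh _) (sq_nonneg _)
    -- integrability
    have hiM4 : Integrable (fun x => M x ^ 4) P :=
      integrable_of_bounded P (hMm.pow_const 4) (C := (n * (2 * Ch)) ^ 4) fun x => by
        rw [abs_pow]; exact pow_le_pow_left₀ (abs_nonneg _) (hMb x) 4
    have hiM3D : Integrable (fun x => M x ^ 3 * D x) P :=
      integrable_of_bounded P (hM3m.mul hDm) (C := (n * (2 * Ch)) ^ 3 * (2 * Ch)) fun x => by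
        rw [abs_mul]; exact mul_le_mul (hM3b x) (hDb x) (abs_nonneg _) (by positivity)
    have hiM2D2 : Integrable (fun x => M x ^ 2 * D x ^ 2) P :=
      integrable_of_bounded P (hM2m.mul (hDm.pow_const 2)) (C := (n * (2 * Ch)) ^ 2 * (2 * Ch) ^ 2)
        fun x => by
          rw [abs_mul, abs_pow (D x)]
          exact mul_le_mul (hM2b x) (pow_le_pow_left₀ (abs_nonneg _) (hDb x) 2)
            (pow_nonneg (abs_nonneg _) 2) (by positivity)
    have hiD4 : Integrable (fun x => D x ^ 4) P :=
      integrable_of_bounded P (hDm.pow_const 4) (C := (2 * Ch) ^ 4) fun x => by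
        rw [abs_pow]; exact pow_le_pow_left₀ (abs_nonneg _) (hDb x) 4
    have hD4 : ∫ x, D x ^ 4 ∂P ≤ (2 * Ch) ^ 4 := by
      calc ∫ x, D x ^ 4 ∂P ≤ ∫ x, (2 * Ch) ^ 4 ∂P := integral_mono hiD4 (integrable_const _)
            fun x => (le_abs_self _).trans (by
              rw [abs_pow]; exact pow_le_pow_left₀ (abs_nonneg _) (hDb x) 4)
        _ = (2 * Ch) ^ 4 := by rw [integral_const, smul_eq_mul, probReal_univ, one_mul]
    -- the pointwise inequality, integrated
    have hpt : ∀ x : ℕ → Ω,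
        (∑ t ∈ Finset.range (n + 1), (h (x (s + t + 1)) - kop κ h (x (s + t)))) ^ 4
        ≤ M x ^ 4 + 4 * (M x ^ 3 * D x) + 8 * (M x ^ 2 * D x ^ 2) + 3 * D x ^ 4 := fun x => by
      rw [Finset.sum_range_succ]
      exact add_pow_four_le (M x) (D x)
    have hub : Integrable (fun x => M x ^ 4 + 4 * (M x ^ 3 * D x) + 8 * (M x ^ 2 * D x ^ 2)
        + 3 * D x ^ 4) P :=
      ((hiM4.add (hiM3D.const_mul 4)).add (hiM2D2.const_mul 8)).add (hiD4.const_mul 3)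
    have hM4m : Measurable fun x : ℕ → Ω =>
        (∑ t ∈ Finset.range (n + 1), (h (x (s + t + 1)) - kop κ h (x (s + t)))) ^ 4 :=
      (blockMartingale_measurable κ hh s (n + 1)).pow_const 4
    have hiL : Integrable (fun x : ℕ → Ω =>
        (∑ t ∈ Finset.range (n + 1), (h (x (s + t + 1)) - kop κ h (x (s + t)))) ^ 4) P :=
      integrable_of_bounded P hM4m (C := ((n + 1 : ℕ) * (2 * Ch)) ^ 4) fun x => by
        rw [abs_pow]
        exact pow_le_pow_left₀ (abs_nonneg _) (abs_blockMartingale_le κ hCh s (n + 1) x) 4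
    have hn0 : (0 : ℝ) ≤ n := Nat.cast_nonneg n
    calc ∫ x, (∑ t ∈ Finset.range (n + 1), (h (x (s + t + 1)) - kop κ h (x (s + t)))) ^ 4 ∂P
        ≤ ∫ x, (M x ^ 4 + 4 * (M x ^ 3 * D x) + 8 * (M x ^ 2 * D x ^ 2) + 3 * D x ^ 4) ∂P :=
          integral_mono hiL hub hpt
      _ = ∫ x, M x ^ 4 ∂P + 4 * ∫ x, M x ^ 3 * D x ∂P + 8 * ∫ x, M x ^ 2 * D x ^ 2 ∂P
          + 3 * ∫ x, D x ^ 4 ∂P := by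
          have hj1 : Integrable (fun x => M x ^ 4 + 4 * (M x ^ 3 * D x)) P :=
            hiM4.add (hiM3D.const_mul 4)
          have hj2 : Integrable (fun x => M x ^ 4 + 4 * (M x ^ 3 * D x) + 8 * (M x ^ 2 * D x ^ 2)) P :=
            hj1.add (hiM2D2.const_mul 8)
          rw [integral_add hj2 (hiD4.const_mul 3), integral_add hj1 (hiM2D2.const_mul 8),
            integral_add hiM4 (hiM3D.const_mul 4), integral_const_mul, integral_const_mul,
            integral_const_mul]
      _ ≤ (4 * (n : ℝ) ^ 2 + 44 * n) * Ch ^ 4 + 4 * 0 + 8 * (Ch ^ 2 * (n * Ch ^ 2))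
          + 3 * (2 * Ch) ^ 4 := by
          have hA : ∫ x, M x ^ 3 * D x ∂P = 0 := horth
          have hB : ∫ x, M x ^ 2 * D x ^ 2 ∂P ≤ Ch ^ 2 * (n * Ch ^ 2) :=
            (le_of_eq hsq).trans (hM2q.trans (mul_le_mul_of_nonneg_left hM2 (sq_nonneg _)))
          rw [hA]
          gcongr
      _ = (4 * ((n + 1 : ℕ) : ℝ) ^ 2 + 44 * ((n + 1 : ℕ) : ℝ)) * Ch ^ 4 := by
          push_cast; ring

/-- The convenient form `E[M_{s,n}⁴] ≤ 48 C_h⁴ n²` for `n ≥ 1`. -/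
theorem chain_blockMartingale_fourth_le' {h : Ω → ℝ} (hh : Measurable h) {Ch : ℝ}
    (hCh : ∀ x, |h x| ≤ Ch) (s : ℕ) {n : ℕ} (hn : n ≠ 0) :
    ∫ x, (∑ t ∈ Finset.range n, (h (x (s + t + 1)) - kop κ h (x (s + t)))) ^ 4
        ∂(Kernel.trajMeasure (X := fun _ : ℕ => Ω) μ₀
          (fun n : ℕ => κ.comap (fun h : (i : ↥(Finset.Iic n)) → Ω => h ⟨n, Finset.mem_Iic.2 le_rfl⟩)
            (measurable_pi_apply _)))
      ≤ 48 * Ch ^ 4 * (n : ℝ) ^ 2 := by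
  refine (chain_blockMartingale_fourth_le κ μ₀ hh hCh s n).trans ?_
  have hn1 : (1 : ℝ) ≤ n := Nat.one_le_cast.2 (Nat.pos_of_ne_zero hn)
  have hC4 : 0 ≤ Ch ^ 4 := by positivity
  have h1 : 4 * (n : ℝ) ^ 2 + 44 * n ≤ 48 * (n : ℝ) ^ 2 := by nlinarith
  calc (4 * (n : ℝ) ^ 2 + 44 * n) * Ch ^ 4 ≤ 48 * (n : ℝ) ^ 2 * Ch ^ 4 :=
        mul_le_mul_of_nonneg_right h1 hC4
    _ = 48 * Ch ^ 4 * (n : ℝ) ^ 2 := by ring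

end BlockMartingale

/-! ### Block sums of a Poisson image: telescoping and moment bounds -/

section Poisson

variable (κ : Kernel Ω Ω) [IsMarkovKernel κ]

omit [MeasurableSpace Ω] in
/-- **Telescoping**: if `h − K h = f̄` pointwise then
`Σ_{t<n} f̄(x_{s+t}) = M_{s,n}(x) + h(x_s) − h(x_{s+n})`. -/
theorem blockSum_eq_blockMartingale_add (K : (Ω → ℝ) → Ω → ℝ) {h fb : Ω → ℝ}
    (hpois : ∀ y, h y - K h y = fb y) (s n : ℕ) (x : ℕ → Ω) :
    ∑ t ∈ Finset.range n, fb (x (s + t))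
      = (∑ t ∈ Finset.range n, (h (x (s + t + 1)) - K h (x (s + t)))) + h (x s) - h (x (s + n)) := by
  have h1 : ∑ t ∈ Finset.range n, fb (x (s + t))
      = ∑ t ∈ Finset.range n, (h (x (s + t + 1)) - K h (x (s + t)))
        + ∑ t ∈ Finset.range n, (h (x (s + t)) - h (x (s + (t + 1)))) := by
    rw [← Finset.sum_add_distrib]
    refine Finset.sum_congr rfl fun t _ => ?_
    rw [← hpois, show s + (t + 1) = s + t + 1 from rfl]
    ring
  rw [h1, Finset.sum_range_sub' (fun t => h (x (s + t))) n]
  simp only [Nat.add_zero]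
  ring

variable (μ₀ : Measure Ω) [IsProbabilityMeasure μ₀]

/-- **Second moment of a block sum from any start**: with `h − kop κ h = f̄`, `|h| ≤ C_h`, `n ≥ 1`:
`E_{μ₀}[(Σ_{t<n} f̄(X_{s+t}))²] ≤ 10 C_h² n`. -/
theorem chain_blockSum_sq_le_of_poisson {h fb : Ω → ℝ} (hh : Measurable h) {Ch : ℝ}
    (hCh : ∀ x, |h x| ≤ Ch) (hfb : Measurable fb) (hpois : ∀ y, h y - kop κ h y = fb y) (s : ℕ)
    {n : ℕ} (hn : n ≠ 0) :
    ∫ x, (∑ t ∈ Finset.range n, fb (x (s + t))) ^ 2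
        ∂(Kernel.trajMeasure (X := fun _ : ℕ => Ω) μ₀
          (fun n : ℕ => κ.comap (fun h : (i : ↥(Finset.Iic n)) → Ω => h ⟨n, Finset.mem_Iic.2 le_rfl⟩)
            (measurable_pi_apply _)))
      ≤ 10 * Ch ^ 2 * n := by
  set P := Kernel.trajMeasure (X := fun _ : ℕ => Ω) μ₀
      (fun n : ℕ => κ.comap (fun h : (i : ↥(Finset.Iic n)) → Ω => h ⟨n, Finset.mem_Iic.2 le_rfl⟩)
        (measurable_pi_apply _)) with hP
  set M : (ℕ → Ω) → ℝ := fun x =>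
    ∑ t ∈ Finset.range n, (h (x (s + t + 1)) - kop κ h (x (s + t))) with hMdef
  have hMm : Measurable M := blockMartingale_measurable κ hh s n
  have hMb : ∀ x, |M x| ≤ n * (2 * Ch) := abs_blockMartingale_le κ hCh s n
  have hM2 : ∫ x, M x ^ 2 ∂P ≤ n * Ch ^ 2 := chain_blockMartingale_sq_le κ μ₀ hh hCh s n
  have hn1 : (1 : ℝ) ≤ n := Nat.one_le_cast.2 (Nat.pos_of_ne_zero hn)
  have hΔb : ∀ x : ℕ → Ω, |h (x s) - h (x (s + n))| ≤ 2 * Ch := fun x =>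
    (abs_sub _ _).trans (by linarith [hCh (x s), hCh (x (s + n))])
  have hpt : ∀ x : ℕ → Ω, (∑ t ∈ Finset.range n, fb (x (s + t))) ^ 2
      ≤ 2 * M x ^ 2 + 2 * (2 * Ch) ^ 2 := fun x => by
    rw [blockSum_eq_blockMartingale_add (kop κ) hpois s n x]
    have h2 : (h (x s) - h (x (s + n))) ^ 2 ≤ (2 * Ch) ^ 2 :=
      (sq_abs _).symm.trans_le (pow_le_pow_left₀ (abs_nonneg _) (hΔb x) 2)
    nlinarith [sq_nonneg (M x - (h (x s) - h (x (s + n))))]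
  have hiL : Integrable (fun x : ℕ → Ω => (∑ t ∈ Finset.range n, fb (x (s + t))) ^ 2) P := by
    have hSm : Measurable fun x : ℕ → Ω => ∑ t ∈ Finset.range n, fb (x (s + t)) :=
      Finset.measurable_sum _ fun t _ => hfb.comp (measurable_pi_apply _)
    refine integrable_of_bounded P (hSm.pow_const 2) (C := (n * (2 * Ch) + 2 * Ch) ^ 2) fun x => ?_
    rw [abs_pow]
    refine pow_le_pow_left₀ (abs_nonneg _) ?_ 2
    rw [blockSum_eq_blockMartingale_add (kop κ) hpois s n x, add_sub_assoc]
    exact (abs_add_le _ _).trans (add_le_add (hMb x) (hΔb x))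
  have hiR : Integrable (fun x => 2 * M x ^ 2 + 2 * (2 * Ch) ^ 2) P :=
    (((integrable_of_bounded P (hMm.pow_const 2) (C := (n * (2 * Ch)) ^ 2) fun x => by
      rw [abs_pow]; exact pow_le_pow_left₀ (abs_nonneg _) (hMb x) 2)).const_mul 2).add
      (integrable_const _)
  calc ∫ x, (∑ t ∈ Finset.range n, fb (x (s + t))) ^ 2 ∂P
      ≤ ∫ x, (2 * M x ^ 2 + 2 * (2 * Ch) ^ 2) ∂P := integral_mono hiL hiR hpt
    _ = 2 * ∫ x, M x ^ 2 ∂P + 2 * (2 * Ch) ^ 2 := by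
        rw [integral_add ((integrable_of_bounded P (hMm.pow_const 2) (C := (n * (2 * Ch)) ^ 2)
          fun x => by rw [abs_pow]; exact pow_le_pow_left₀ (abs_nonneg _) (hMb x) 2).const_mul 2)
          (integrable_const _), integral_const_mul, integral_const, smul_eq_mul, probReal_univ,
          one_mul]
    _ ≤ 2 * (n * Ch ^ 2) + 2 * (2 * Ch) ^ 2 := by linarith
    _ ≤ 10 * Ch ^ 2 * n := by nlinarith [sq_nonneg Ch]

/-- **FOURTH MOMENT OF A BLOCK SUM FROM ANY START**: with `h − kop κ h = f̄`, `|h| ≤ C_h`, `n ≥ 1`: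
`E_{μ₀}[(Σ_{t<n} f̄(X_{s+t}))⁴] ≤ 512 C_h⁴ n²`, uniformly in `s` and in the initial law `μ₀`. -/
theorem chain_blockSum_fourth_le_of_poisson {h fb : Ω → ℝ} (hh : Measurable h) {Ch : ℝ}
    (hCh : ∀ x, |h x| ≤ Ch) (hfb : Measurable fb) (hpois : ∀ y, h y - kop κ h y = fb y) (s : ℕ)
    {n : ℕ} (hn : n ≠ 0) :
    ∫ x, (∑ t ∈ Finset.range n, fb (x (s + t))) ^ 4
        ∂(Kernel.trajMeasure (X := fun _ : ℕ => Ω) μ₀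
          (fun n : ℕ => κ.comap (fun h : (i : ↥(Finset.Iic n)) → Ω => h ⟨n, Finset.mem_Iic.2 le_rfl⟩)
            (measurable_pi_apply _)))
      ≤ 512 * Ch ^ 4 * (n : ℝ) ^ 2 := by
  set P := Kernel.trajMeasure (X := fun _ : ℕ => Ω) μ₀
      (fun n : ℕ => κ.comap (fun h : (i : ↥(Finset.Iic n)) → Ω => h ⟨n, Finset.mem_Iic.2 le_rfl⟩)
        (measurable_pi_apply _)) with hP
  set M : (ℕ → Ω) → ℝ := fun x =>
    ∑ t ∈ Finset.range n, (h (x (s + t + 1)) - kop κ h (x (s + t))) with hMdef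
  have hMm : Measurable M := blockMartingale_measurable κ hh s n
  have hMb : ∀ x, |M x| ≤ n * (2 * Ch) := abs_blockMartingale_le κ hCh s n
  have hM4 : ∫ x, M x ^ 4 ∂P ≤ 48 * Ch ^ 4 * (n : ℝ) ^ 2 :=
    chain_blockMartingale_fourth_le' κ μ₀ hh hCh s hn
  have hn1 : (1 : ℝ) ≤ n := Nat.one_le_cast.2 (Nat.pos_of_ne_zero hn)
  have hΔb : ∀ x : ℕ → Ω, |h (x s) - h (x (s + n))| ≤ 2 * Ch := fun x =>
    (abs_sub _ _).trans (by linarith [hCh (x s), hCh (x (s + n))])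
  have hpt : ∀ x : ℕ → Ω, (∑ t ∈ Finset.range n, fb (x (s + t))) ^ 4
      ≤ 8 * M x ^ 4 + 8 * (2 * Ch) ^ 4 := fun x => by
    rw [blockSum_eq_blockMartingale_add (kop κ) hpois s n x]
    have h2 : (h (x s) - h (x (s + n))) ^ 2 ≤ (2 * Ch) ^ 2 :=
      (sq_abs _).symm.trans_le (pow_le_pow_left₀ (abs_nonneg _) (hΔb x) 2)
    have h4 : (h (x s) - h (x (s + n))) ^ 4 ≤ (2 * Ch) ^ 4 := by
      have := pow_le_pow_left₀ (abs_nonneg _) (hΔb x) 4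
      rwa [pow_abs, abs_of_nonneg (by positivity : (0 : ℝ) ≤ (h (x s) - h (x (s + n))) ^ 4)]
        at this
    -- `(a + b)⁴ ≤ 8 (a⁴ + b⁴)`
    have key : ∀ a b : ℝ, (a + b) ^ 4 ≤ 8 * a ^ 4 + 8 * b ^ 4 := fun a b => by
      nlinarith [sq_nonneg (a - b), sq_nonneg (a + b), sq_nonneg (a ^ 2 - b ^ 2),
        sq_nonneg (a * b), mul_self_nonneg (a - b), sq_nonneg ((a - b) * (a + b))]
    have := key (M x) (h (x s) - h (x (s + n)))
    rw [add_sub_assoc]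
    linarith
  have hSm : Measurable fun x : ℕ → Ω => ∑ t ∈ Finset.range n, fb (x (s + t)) :=
    Finset.measurable_sum _ fun t _ => hfb.comp (measurable_pi_apply _)
  have hiL : Integrable (fun x : ℕ → Ω => (∑ t ∈ Finset.range n, fb (x (s + t))) ^ 4) P := by
    refine integrable_of_bounded P (hSm.pow_const 4) (C := (n * (2 * Ch) + 2 * Ch) ^ 4) fun x => ?_
    rw [abs_pow]
    refine pow_le_pow_left₀ (abs_nonneg _) ?_ 4
    rw [blockSum_eq_blockMartingale_add (kop κ) hpois s n x, add_sub_assoc]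
    exact (abs_add_le _ _).trans (add_le_add (hMb x) (hΔb x))
  have hiM4 : Integrable (fun x => M x ^ 4) P :=
    integrable_of_bounded P (hMm.pow_const 4) (C := (n * (2 * Ch)) ^ 4) fun x => by
      rw [abs_pow]; exact pow_le_pow_left₀ (abs_nonneg _) (hMb x) 4
  have hiR : Integrable (fun x => 8 * M x ^ 4 + 8 * (2 * Ch) ^ 4) P :=
    (hiM4.const_mul 8).add (integrable_const _)
  have hC4 : 0 ≤ Ch ^ 4 := by positivity
  calc ∫ x, (∑ t ∈ Finset.range n, fb (x (s + t))) ^ 4 ∂P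
      ≤ ∫ x, (8 * M x ^ 4 + 8 * (2 * Ch) ^ 4) ∂P := integral_mono hiL hiR hpt
    _ = 8 * ∫ x, M x ^ 4 ∂P + 8 * (2 * Ch) ^ 4 := by
        rw [integral_add (hiM4.const_mul 8) (integrable_const _), integral_const_mul,
          integral_const, smul_eq_mul, probReal_univ, one_mul]
    _ ≤ 8 * (48 * Ch ^ 4 * (n : ℝ) ^ 2) + 8 * (2 * Ch) ^ 4 := by linarith
    _ ≤ 512 * Ch ^ 4 * (n : ℝ) ^ 2 := by
        have h1 : Ch ^ 4 ≤ (n : ℝ) ^ 2 * Ch ^ 4 := le_mul_of_one_le_left hC4 (by nlinarith)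
        nlinarith

end Poisson

end Summit.Ventures.LatticeQCDFlow.Scoring

end
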